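import Mathlib
import Summits.Schanuel.Schanuel.Theses.RigidCore
import Summits.Schanuel.Schanuel.Theorems.RigidCoreMinimalCounterexampleInAclLogSector
import Summits.Schanuel.Schanuel.Theorems.RigidCoreMinimalCounterexampleInAclAclCriterion
import Summits.Schanuel.Schanuel.Theorems.RigidCoreMinimalCounterexampleInAclMixedBridge
import Summits.Schanuel.Schanuel.Theorems.AclSubsetLogFreeCore.Negative.ExpAclDefinability
import Literature.ModelTheory.ExponentialFields.DefinabilityParams

/-!
# CELL SELECTORS — joint window selection in several mixed directions, every rank
# (crux stmt-Schanuel-0969 `RigidCore.MinimalCounterexampleInAcl`)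

Line `kernel-arithmetic-selection` (lead prover-line-stmt-Schanuel-0969-c5-0), `--supports stmt-Schanuel-0969`; infrastructure for the
registered stub `stub_geThree` (= item stmt-Schanuel-14744, (S*) in the ranks `n ≥ 3`; cf. 14744's ideation card `window-cells`).

At rank 2 the mixed sector of (S*) is settled by selectors on ONE `∅`-definable value set `E ⊆ ℂ` lying on finitely many cosets of
`2πiℤ` (Theorems/…SelectorOneSided, …SelectorWindow, …MixedSector).  In rank `n = m + 1` with `m` mixed directions
`M₁, …, M_m` (`e^{M_k·x} ∈ ℚ̄`) the natural object is the JOINT value set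
`V = {(M_k·x')_k : x' ∈ locusMates x} ⊆ ℂ^m`, an `∅`-definable set lying on finitely many cosets of `(2πiℤ)^m`.  This file proves
the two selectors for such `V` and the resulting reduction of the corank-one mixed sector of (S*) to ONE finiteness statement:

* `valueTuples_definable`, `cexp_image_valueTuples_finite` — `V` (always written as a set-builder) is `∅`-definable and `{exp ∘ v : v ∈ V}` is finite;
* `cellSelector` — if a finite CELL `G ⊆ ℤ^m` is realised in `V` at `u + 2πiκ₀` and both one-signed cell-position sets
  `{v : ∀ g ∈ G, v ± 2πig ∈ V}` are finite, then every `u_k ∈ acl(∅)` (the cell-position set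
  `{v | ∃ t ∈ {±2πi}, ∀ g ∈ G, v + t·g ∈ V}` is a finite `∅`-definable subset of `ℂ^m` containing `u + 2πiκ₀`);
* `finiteClassSelector` — if `u ∈ V` and the hit set `{κ ∈ ℤ^m : u + 2πiκ ∈ V}` is FINITE, then every `u_k ∈ acl(∅)` (the set of
  `v ∈ V` whose exact hit pattern w.r.t. a kernel generator is that of `u` is `∅`-definable and meets each coset class in ≤ 2 points);
* `mem_expAcl_of_corankOne_cellRecurrence` (registered form `stub_corankOneMixed_cellRecurrence`) — **(S*) ON THE CORANK-ONE MIXED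
  SECTOR OF EVERY RANK FOLLOWS FROM CELL-RECURRENCE FINITENESS**: if large cells recur at finitely many positions of `V`, then every
  coordinate of the first failure `x` is in `acl(∅)` (hit set finite ⇒ `finiteClassSelector`; infinite ⇒ it contains a large cell,
  `cellSelector`; then the acl-field criterion `firstFailure_mem_expAcl_of_intCombos`).  Cell recurrence constrains all directions
  jointly and is weaker than window recurrence in each direction separately (Theorems/…MixedSelectorsAllRanks).

References: [KirbyMacintyreOnshuus2012] J. Kirby, A. Macintyre, A. Onshuus, *The algebraic numbers definable in various exponential
fields*, J. Inst. Math. Jussieu 11 (2012), arXiv:1101.4224, §2 (`ℤ` and `±2πi` are `∅`-definable in `ℂ_exp`); [Marker2002] D. Marker,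
*Model Theory: An Introduction*, GTM 217, §1.3 (`acl`); [Kirby2010] J. Kirby, *Exponential algebraicity in exponential fields*,
Bull. LMS 42 (2010), arXiv:0810.4285, Prop. 7.2.
-/

noncomputable section

set_option linter.dupNamespace false

open Complex Set FirstOrder

namespace Summit.Schanuel.Schanuel.Cruxes.MinimalCounterexampleInAcl.KernelArithmeticSelection

open Literature.NumberTheory.Transcendental (SchanuelRank)
open Literature.ModelTheory.ExponentialFields
open Summit.Schanuel.Schanuel.Theorems.AclSubsetLogFreeCore.Negative

variable {n m : ℕ}

/-! ## The joint value set of `m` integer directions on the mates -/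

/-! Throughout, the JOINT VALUE SET of the directions `M : Fin m → Fin n → ℤ` on the mates of `x` is written out as the
set-builder `{v : Fin m → ℂ | ∃ x' ∈ locusMates x, ∀ k, v k = ∑ i, (M k i : ℂ) * x' i}` (no auxiliary definition). -/

/-- The value tuple of `x` itself lies in the joint value set when `x` is ℚ-linearly independent. -/
theorem self_mem_valueTuples {x : Fin n → ℂ} (hx : LinearIndependent ℚ x) (M : Fin m → Fin n → ℤ) :
    (fun k => ∑ i, (M k i : ℂ) * x i) ∈ {v : Fin m → ℂ | ∃ x' ∈ locusMates x, ∀ k, v k = ∑ i, (M k i : ℂ) * x' i} :=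
  ⟨x, self_mem_locusMates x hx, fun _ => rfl⟩

/-- **The joint value set is `∅`-definable in `ℂ_exp`** (projection of the definable graph
`{(v, x') | x' ∈ locusMates x ∧ ∀ k, v_k = Σᵢ M_{ki} x'ᵢ}` along the `x'`-coordinates). [cite: KirbyMacintyreOnshuus2012, §2] -/
theorem valueTuples_definable (x : Fin n → ℂ) (M : Fin m → Fin n → ℤ) :
    (∅ : Set ℂ).Definable Language.expRing
      {v : Fin m → ℂ | ∃ x' ∈ locusMates x, ∀ k, v k = ∑ i, (M k i : ℂ) * x' i} := by
  have hgraph : (∅ : Set ℂ).Definable Language.expRing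
      {w : Fin m ⊕ Fin n → ℂ | w ∘ Sum.inr ∈ locusMates x ∧
        ∀ k, w (Sum.inl k) = ∑ i, (M k i : ℂ) * w (Sum.inr i)} := by
    refine definable_setOf_and_params ((locusMates_definable x).preimage_comp Sum.inr) ?_
    rw [Set.setOf_forall]
    exact Set.definable_iInter_of_finite fun k =>
      definable_setOf_eq_params (definableFun_proj_params _)
        (definableFun_finsetSum _ fun i _ =>
          definableFun_mul' (definableFun_intCast' _) (definableFun_proj_params _))
  have h := hgraph.exists_of_finite
  convert h using 1
  ext v
  simp only [mem_setOf_eq, Sum.elim_comp_inr, Sum.elim_inl, Sum.elim_inr]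

/-- **`{exp ∘ v : v ∈ V}` is finite for the joint value set `V` when every `e^{M_k·x}` is algebraic**: coordinatewise the exponentials are roots of
the rational polynomials annihilating the `e^{M_k·x}` (`cexp_image_intCombo_locusMates_finite`). [folklore] -/
theorem cexp_image_valueTuples_finite (x : Fin n → ℂ) (M : Fin m → Fin n → ℤ)
    (halg : ∀ k, IsAlgebraic ℚ (cexp (∑ i, (M k i : ℂ) * x i))) :
    ((fun v : Fin m → ℂ => cexp ∘ v) '' {v : Fin m → ℂ | ∃ x' ∈ locusMates x, ∀ k, v k = ∑ i, (M k i : ℂ) * x' i}).Finite := by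
  have hk : ∀ k, (cexp '' {s : ℂ | ∃ x' ∈ locusMates x, s = ∑ i, (M k i : ℂ) * x' i}).Finite := fun k =>
    cexp_image_intCombo_locusMates_finite x (M k) (halg k)
  refine (Set.Finite.pi (t := fun k => cexp '' {s : ℂ | ∃ x' ∈ locusMates x, s = ∑ i, (M k i : ℂ) * x' i}) hk).subset ?_
  rintro _ ⟨v, ⟨x', hx', hv⟩, rfl⟩
  exact Set.mem_univ_pi.2 fun k => ⟨v k, ⟨x', hx', hv k⟩, rfl⟩

/-! ## The cell selector -/

/-- The cell-position set `{v | ∃ t ∈ {±2πi}, ∀ g ∈ G, v + t·g ∈ V}` lies in the union of the two one-signed cell-position sets.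
[cite: KirbyMacintyreOnshuus2012, §2] -/
theorem cellSet_subset_union (V : Set (Fin m → ℂ)) (G : Finset (Fin m → ℤ)) :
    {v : Fin m → ℂ | ∃ t : ℂ, t ∈ kerGenSet ∧ ∀ g ∈ G, (fun k => v k + t * (g k : ℂ)) ∈ V} ⊆
      {v : Fin m → ℂ | ∀ g ∈ G, (fun k => v k + 2 * ↑Real.pi * I * (g k : ℂ)) ∈ V} ∪
        {v : Fin m → ℂ | ∀ g ∈ G, (fun k => v k - 2 * ↑Real.pi * I * (g k : ℂ)) ∈ V} := by
  rintro v ⟨t, ht, hv⟩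
  rcases mem_kerGenSet_iff.1 ht with rfl | rfl
  · exact Or.inl hv
  · refine Or.inr fun g hg => ?_
    have h := hv g hg
    simpa only [neg_mul, ← sub_eq_add_neg] using h

/-- The cell-position set of an `∅`-definable `V ⊆ ℂ^m` is `∅`-definable (`t ∈ {±2πi}` is parameter-free, KMO 2012 §2.3; the cell
condition is a finite conjunction of `V`-atoms in the definable tuple `v + t·g`). [cite: KirbyMacintyreOnshuus2012, §2] -/
theorem definable_cellSet {V : Set (Fin m → ℂ)} (hV : (∅ : Set ℂ).Definable Language.expRing V)
    (G : Finset (Fin m → ℤ)) :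
    (∅ : Set ℂ).Definable Language.expRing
      {v : Fin m → ℂ | ∃ t : ℂ, t ∈ kerGenSet ∧ ∀ g ∈ G, (fun k => v k + t * (g k : ℂ)) ∈ V} := by
  refine definable_setOf_exists_params (definable_setOf_and_params ?_ ?_)
  · exact definable_mem_kerGenSet (definableFun_proj_params _)
  · have hG : (∅ : Set ℂ).Definable Language.expRing
        (⋂ g ∈ G, {w : Fin m ⊕ Unit → ℂ |
          (fun k => w (Sum.inl k) + w (Sum.inr ()) * (g k : ℂ)) ∈ V}) := by
      refine Set.definable_biInter_finset (fun g => ?_) G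
      have hF : (∅ : Set ℂ).DefinableMap Language.expRing
          (fun (w : Fin m ⊕ Unit → ℂ) (k : Fin m) => w (Sum.inl k) + w (Sum.inr ()) * (g k : ℂ)) := fun k =>
        definableFun_add' (definableFun_proj_params _)
          (definableFun_mul' (definableFun_proj_params _) (definableFun_intCast' _))
      exact hV.preimage_map hF
    convert hG using 1
    ext w
    simp only [Set.mem_setOf_eq, Set.mem_iInter]

/-- **THE CELL SELECTOR.**  Let `V ⊆ ℂ^m` be `∅`-definable in `ℂ_exp`, let the finite cell `G ⊆ ℤ^m` be realised in `V` at
`u + 2πiκ₀` (`u + 2πi(κ₀ + g) ∈ V` for `g ∈ G`), and let both one-signed cell-position sets `{v | ∀ g ∈ G, v ± 2πig ∈ V}` be finite.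
Then every coordinate `u_k ∈ acl^{ℂ_exp}(∅)`: the cell-position set is a finite `∅`-definable subset of `ℂ^m` containing `u + 2πiκ₀`,
its coordinate projections are finite `∅`-definable subsets of `ℂ`, and `acl(∅)` is a ring containing `2πi` and `ℤ`.
[cite: KirbyMacintyreOnshuus2012, §2] -/
theorem cellSelector {V : Set (Fin m → ℂ)} (hV : (∅ : Set ℂ).Definable Language.expRing V)
    (u : Fin m → ℂ) (G : Finset (Fin m → ℤ)) (κ₀ : Fin m → ℤ)
    (hwin : ∀ g ∈ G, (fun k => u k + 2 * ↑Real.pi * I * ((κ₀ k + g k : ℤ) : ℂ)) ∈ V)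
    (hfinP : Set.Finite {v : Fin m → ℂ | ∀ g ∈ G, (fun k => v k + 2 * ↑Real.pi * I * (g k : ℂ)) ∈ V})
    (hfinN : Set.Finite {v : Fin m → ℂ | ∀ g ∈ G, (fun k => v k - 2 * ↑Real.pi * I * (g k : ℂ)) ∈ V}) :
    ∀ k, u k ∈ expAcl := by
  intro k
  set S : Set (Fin m → ℂ) :=
    {v : Fin m → ℂ | ∃ t : ℂ, t ∈ kerGenSet ∧ ∀ g ∈ G, (fun k => v k + t * (g k : ℂ)) ∈ V} with hS
  have hmem : (fun k => u k + 2 * ↑Real.pi * I * (κ₀ k : ℂ)) ∈ S := by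
    refine ⟨2 * ↑Real.pi * I, mem_kerGenSet_iff.2 (Or.inl rfl), fun g hg => ?_⟩
    have e : (fun k => u k + 2 * ↑Real.pi * I * (κ₀ k : ℂ) + 2 * ↑Real.pi * I * (g k : ℂ)) =
        fun k => u k + 2 * ↑Real.pi * I * ((κ₀ k + g k : ℤ) : ℂ) := by
      funext k; push_cast; ring
    rw [e]
    exact hwin g hg
  have hfin : S.Finite := (hfinP.union hfinN).subset (cellSet_subset_union V G)
  have h1 : u k + 2 * ↑Real.pi * I * (κ₀ k : ℂ) ∈ expAcl :=
    coord_mem_expAcl hfin (definable_cellSet hV G) hmem k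
  have h2 : -(2 * ↑Real.pi * I * (κ₀ k : ℂ)) ∈ expAcl :=
    neg_mem_expAcl (mul_mem_expAcl two_pi_I_mem_expAcl (intCast_mem_expAcl _))
  have h3 := add_mem_expAcl h1 h2
  rwa [add_neg_cancel_right] at h3

/-! ## The finite-class selector -/

/-- Injectivity core of the finite-class selector: if the exact hit pattern `{κ ∈ ℤ^m : v + t·κ ∈ V}` of `v` equals the finite set
`H ∋ 0` and the same holds for the translate `v + t·μ` (`μ ∈ ℤ^m`, `t ≠ 0`), then `μ = 0` — translation by `μ` permutes `H`, and
summing over `H` gives `|H| • μ = 0`. [folklore] -/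
theorem eq_zero_of_pattern_translate {V : Set (Fin m → ℂ)} {t : ℂ} {H : Finset (Fin m → ℤ)} (h0 : (0 : Fin m → ℤ) ∈ H)
    {v : Fin m → ℂ} (μ : Fin m → ℤ)
    (hv : ∀ κ : Fin m → ℤ, (fun k => v k + t * (κ k : ℂ)) ∈ V → κ ∈ H)
    (hv' : ∀ κ ∈ H, (fun k => (v k + t * (μ k : ℂ)) + t * (κ k : ℂ)) ∈ V) : μ = 0 := by
  classical
  -- translation by `μ` maps `H` into `H`
  have hmap : ∀ κ ∈ H, μ + κ ∈ H := by
    intro κ hκ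
    refine hv (μ + κ) ?_
    have e : (fun k => v k + t * ((μ + κ : Fin m → ℤ) k : ℂ)) = fun k => (v k + t * (μ k : ℂ)) + t * (κ k : ℂ) := by
      funext k; simp only [Pi.add_apply, Int.cast_add]; ring
    rw [e]; exact hv' κ hκ
  have himg : H.image (fun κ => μ + κ) = H := by
    refine Finset.eq_of_subset_of_card_le (fun κ hκ => ?_) ?_
    · obtain ⟨κ', hκ', rfl⟩ := Finset.mem_image.1 hκ
      exact hmap κ' hκ'
    · rw [Finset.card_image_of_injective _ (add_right_injective μ)]
  have hsum : ∑ κ ∈ H, (μ + κ) = ∑ κ ∈ H, κ := by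
    conv_rhs => rw [← himg]
    rw [Finset.sum_image fun a _ b _ h => add_right_injective μ h]
  rw [Finset.sum_add_distrib, Finset.sum_const, add_eq_right] at hsum
  have hcard : H.card ≠ 0 := Finset.card_ne_zero.2 ⟨0, h0⟩
  exact (smul_eq_zero.1 hsum).resolve_left hcard

/-- Two tuples with the same coordinatewise exponentials differ by `t·μ` for an integer vector `μ`, for either kernel generator
`t = ±2πi`. [folklore] -/
theorem exists_int_translate_of_cexp_eq {t : ℂ} (ht : t ∈ kerGenSet) {v v' : Fin m → ℂ}
    (h : (cexp ∘ v') = (cexp ∘ v)) : ∃ μ : Fin m → ℤ, v' = fun k => v k + t * (μ k : ℂ) := by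
  have hk : ∀ k, ∃ n : ℤ, v' k = v k + n * (2 * ↑Real.pi * I) := fun k =>
    Complex.exp_eq_exp_iff_exists_int.1 (congrFun h k)
  choose nn hnn using hk
  rcases mem_kerGenSet_iff.1 ht with rfl | rfl
  · exact ⟨nn, funext fun k => by rw [hnn k]; ring⟩
  · exact ⟨-nn, funext fun k => by rw [hnn k]; simp only [Pi.neg_apply, Int.cast_neg]; ring⟩

/-- Definability of the exact-pattern set: for an `∅`-definable `V ⊆ ℂ^m` and a finite `H ⊆ ℤ^m`, the set of `v` such that for some
kernel generator `t ∈ {±2πi}` the hit pattern `{κ ∈ ℤ^m : v + t·κ ∈ V}` is EXACTLY `H` is `∅`-definable (`ℤ` is `∅`-definable, KMO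
2012 §2.2, so "for all integer vectors" is a first-order quantifier; `H` is a finite list of numerals). [cite: KirbyMacintyreOnshuus2012, §2] -/
theorem definable_patternSet {V : Set (Fin m → ℂ)} (hV : (∅ : Set ℂ).Definable Language.expRing V)
    (H : Finset (Fin m → ℤ)) :
    (∅ : Set ℂ).Definable Language.expRing
      {v : Fin m → ℂ | ∃ t : ℂ, t ∈ kerGenSet ∧
        ((∀ κ ∈ H, (fun k => v k + t * (κ k : ℂ)) ∈ V) ∧
          ∀ w : Fin m → ℂ, (∀ k, w k ∈ intSet) → (fun k => v k + t * w k) ∈ V →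
            ∃ κ ∈ H, ∀ k, w k = (κ k : ℂ))} := by
  classical
  refine definable_setOf_exists_params (definable_setOf_and_params ?_ (definable_setOf_and_params ?_ ?_))
  · exact definable_mem_kerGenSet (definableFun_proj_params _)
  · -- the finite conjunction over `H`
    have hG : (∅ : Set ℂ).Definable Language.expRing
        (⋂ κ ∈ H, {w : Fin m ⊕ Unit → ℂ |
          (fun k => w (Sum.inl k) + w (Sum.inr ()) * (κ k : ℂ)) ∈ V}) := by
      refine Set.definable_biInter_finset (fun κ => ?_) H
      have hF : (∅ : Set ℂ).DefinableMap Language.expRing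
          (fun (w : Fin m ⊕ Unit → ℂ) (k : Fin m) => w (Sum.inl k) + w (Sum.inr ()) * (κ k : ℂ)) := fun k =>
        definableFun_add' (definableFun_proj_params _)
          (definableFun_mul' (definableFun_proj_params _) (definableFun_intCast' _))
      exact hV.preimage_map hF
    convert hG using 1
    ext w
    simp only [Set.mem_setOf_eq, Set.mem_iInter]
  · -- the universal quantifier over integer vectors `w` (a `Fin m`-block of bound variables)
    have hZ : (∅ : Set ℂ).Definable Language.expRing
        {z : (Fin m ⊕ Unit) ⊕ Fin m → ℂ | (∀ k, z (Sum.inr k) ∈ intSet) →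
          (fun k => z (Sum.inl (Sum.inl k)) + z (Sum.inl (Sum.inr ())) * z (Sum.inr k)) ∈ V →
            ∃ κ ∈ H, ∀ k, z (Sum.inr k) = (κ k : ℂ)} := by
      refine definable_setOf_imp_params ?_ (definable_setOf_imp_params ?_ ?_)
      · rw [Set.setOf_forall]
        exact Set.definable_iInter_of_finite fun k => definable_mem_intSet (definableFun_proj_params _)
      · have hF : (∅ : Set ℂ).DefinableMap Language.expRing
            (fun (z : (Fin m ⊕ Unit) ⊕ Fin m → ℂ) (k : Fin m) =>
              z (Sum.inl (Sum.inl k)) + z (Sum.inl (Sum.inr ())) * z (Sum.inr k)) := fun k =>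
          definableFun_add' (definableFun_proj_params _)
            (definableFun_mul' (definableFun_proj_params _) (definableFun_proj_params _))
        exact hV.preimage_map hF
      · have hU : (∅ : Set ℂ).Definable Language.expRing
            (⋃ κ ∈ H, ⋂ k : Fin m, {z : (Fin m ⊕ Unit) ⊕ Fin m → ℂ | z (Sum.inr k) = (κ k : ℂ)}) := by
          refine Set.definable_biUnion_finset (fun κ => ?_) H
          exact Set.definable_iInter_of_finite fun k =>
            definable_setOf_eq_params (definableFun_proj_params _) (definableFun_intCast' _)
        convert hU using 1
        ext z
        simp only [Set.mem_setOf_eq, Set.mem_iUnion, Set.mem_iInter, exists_prop]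
    have h := hZ.forall_of_finite
    convert h using 1
    ext w
    simp only [Set.mem_setOf_eq, Sum.elim_inl, Sum.elim_inr]

/-- **THE FINITE-CLASS SELECTOR.**  Let `V ⊆ ℂ^m` be `∅`-definable in `ℂ_exp` with `{exp ∘ v : v ∈ V}` finite (so `V` lies on finitely
many cosets of `(2πiℤ)^m`), `u ∈ V`, and suppose the hit set `{κ ∈ ℤ^m : u + 2πiκ ∈ V}` of `u`'s coset is FINITE.  Then every
coordinate `u_k ∈ acl^{ℂ_exp}(∅)`: the set of `v` whose exact hit pattern (for a kernel generator) is that of `u` is `∅`-definable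
(`definable_patternSet`), contains `u`, and is finite — on each sign it lies in `V` and `exp ∘ ·` is injective on it
(`eq_zero_of_pattern_translate`). This is the `m`-dimensional form of the one-sided selector at a finite hit set.
[cite: KirbyMacintyreOnshuus2012, §2] -/
theorem finiteClassSelector {V : Set (Fin m → ℂ)} (hV : (∅ : Set ℂ).Definable Language.expRing V)
    (hVfin : ((fun v : Fin m → ℂ => cexp ∘ v) '' V).Finite) {u : Fin m → ℂ} (hu : u ∈ V)
    (hH : Set.Finite {κ : Fin m → ℤ | (fun k => u k + 2 * ↑Real.pi * I * (κ k : ℂ)) ∈ V}) :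
    ∀ k, u k ∈ expAcl := by
  classical
  intro k
  set H : Finset (Fin m → ℤ) := hH.toFinset with hHdef
  have hmemH : ∀ κ : Fin m → ℤ, κ ∈ H ↔ (fun k => u k + 2 * ↑Real.pi * I * (κ k : ℂ)) ∈ V := fun κ => by
    rw [hHdef, Set.Finite.mem_toFinset]; rfl
  have h0 : (0 : Fin m → ℤ) ∈ H := by
    rw [hmemH]; simpa using hu
  -- the pattern predicate for a generator `t`
  set Pat : ℂ → (Fin m → ℂ) → Prop := fun t v =>
    (∀ κ ∈ H, (fun k => v k + t * (κ k : ℂ)) ∈ V) ∧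
      ∀ w : Fin m → ℂ, (∀ k, w k ∈ intSet) → (fun k => v k + t * w k) ∈ V →
        ∃ κ ∈ H, ∀ k, w k = (κ k : ℂ) with hPat
  set T : Set (Fin m → ℂ) := {v | ∃ t : ℂ, t ∈ kerGenSet ∧ Pat t v} with hT
  -- `u ∈ T` via `t = 2πi`
  have huT : u ∈ T := by
    refine ⟨2 * ↑Real.pi * I, mem_kerGenSet_iff.2 (Or.inl rfl), fun κ hκ => ?_, fun w hw hwV => ?_⟩
    · have e : (fun k => u k + 2 * ↑Real.pi * I * (κ k : ℂ)) = fun k => u k + 2 * ↑Real.pi * I * (κ k : ℂ) := rfl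
      exact (hmemH κ).1 hκ
    · choose κ hκ using fun k => mem_intSet_iff.1 (hw k)
      refine ⟨κ, (hmemH κ).2 ?_, hκ⟩
      have e : (fun k => u k + 2 * ↑Real.pi * I * (κ k : ℂ)) = fun k => u k + 2 * ↑Real.pi * I * w k := by
        funext k; rw [hκ k]
      rw [e]; exact hwV
  -- `T` is definable
  have hTdef : (∅ : Set ℂ).Definable Language.expRing T := definable_patternSet hV H
  -- `T` is finite: on each sign, `T_t ⊆ V` and `exp ∘ ·` is injective on `T_t`
  have hTt : ∀ t : ℂ, t ∈ kerGenSet → Set.Finite {v | Pat t v} := by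
    intro t ht
    have hsub : {v | Pat t v} ⊆ V := by
      intro v hv
      have h := hv.1 0 h0
      simpa using h
    refine Set.Finite.of_finite_image (hVfin.subset (Set.image_mono hsub)) ?_
    intro v hv v' hv' hvv'
    obtain ⟨μ, rfl⟩ := exists_int_translate_of_cexp_eq ht hvv'.symm
    have hμ : μ = 0 :=
      eq_zero_of_pattern_translate (V := V) (t := t) h0 μ
        (fun κ hκ => by
          obtain ⟨κ', hκ', hκκ'⟩ := hv.2 (fun k => (κ k : ℂ)) (fun k => mem_intSet_iff.2 ⟨κ k, rfl⟩) hκ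
          have : κ = κ' := funext fun k => by exact_mod_cast hκκ' k
          rw [this]; exact hκ')
        (fun κ hκ => hv'.1 κ hκ)
    subst hμ
    funext k; simp
  have hTfin : T.Finite := by
    have hcover : T ⊆ {v | Pat (2 * ↑Real.pi * I) v} ∪ {v | Pat (-(2 * ↑Real.pi * I)) v} := by
      rintro v ⟨t, ht, hv⟩
      rcases mem_kerGenSet_iff.1 ht with rfl | rfl
      · exact Or.inl hv
      · exact Or.inr hv
    exact ((hTt _ (mem_kerGenSet_iff.2 (Or.inl rfl))).union (hTt _ (mem_kerGenSet_iff.2 (Or.inr rfl)))).subset hcover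
  exact coord_mem_expAcl hTfin hTdef huT k

/-! ## The corank-one mixed sector from CELL-RECURRENCE FINITENESS, every rank -/

/-- **Joint values with CELL-RECURRENCE FINITENESS are in `acl(∅)` (every rank, any number of mixed directions).**  For a ℚ-linearly
independent `x` and integer directions `M_k` with `e^{M_k·x}` algebraic: if cells of every size `≥ L` recur at finitely many positions of
the joint value set `V`, then every `M_k·x ∈ acl^{ℂ_exp}(∅)`.  Dichotomy on the hit set `{κ ∈ ℤ^m : u + 2πiκ ∈ V}` of `u = (M_k·x)_k`:
finite ⇒ `finiteClassSelector`; infinite ⇒ it contains a cell of size `L + 1` through `u + 2πiκ₀`, whose position set and mirror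
position set are finite by hypothesis ⇒ `cellSelector`. [cite: KirbyMacintyreOnshuus2012, §2] -/
theorem intCombos_mem_expAcl_of_cellRecurrence {x : Fin n → ℂ} (hx : LinearIndependent ℚ x) (M : Fin m → Fin n → ℤ)
    (halg : ∀ k, IsAlgebraic ℚ (cexp (∑ i, (M k i : ℂ) * x i)))
    (hrec : ∃ L : ℕ, ∀ G : Finset (Fin m → ℤ), L ≤ G.card →
      Set.Finite {v : Fin m → ℂ | ∀ g ∈ G, (fun k => v k + 2 * ↑Real.pi * I * (g k : ℂ)) ∈
        {v : Fin m → ℂ | ∃ x' ∈ locusMates x, ∀ k, v k = ∑ i, (M k i : ℂ) * x' i}}) :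
    ∀ k, (∑ i, (M k i : ℂ) * x i) ∈ expAcl := by
  classical
  set V : Set (Fin m → ℂ) := {v : Fin m → ℂ | ∃ x' ∈ locusMates x, ∀ k, v k = ∑ i, (M k i : ℂ) * x' i} with hV
  set u : Fin m → ℂ := fun k => ∑ i, (M k i : ℂ) * x i with hu
  have hVdef : (∅ : Set ℂ).Definable Language.expRing V := valueTuples_definable x M
  have hVfin : ((fun v : Fin m → ℂ => cexp ∘ v) '' V).Finite := cexp_image_valueTuples_finite x M halg
  have huV : u ∈ V := self_mem_valueTuples hx M
  set Hs : Set (Fin m → ℤ) := {κ : Fin m → ℤ | (fun k => u k + 2 * ↑Real.pi * I * (κ k : ℂ)) ∈ V} with hHs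
  by_cases hHfin : Hs.Finite
  · exact finiteClassSelector hVdef hVfin huV hHfin
  · obtain ⟨L, hL⟩ := hrec
    have hHinf : Hs.Infinite := hHfin
    obtain ⟨F, hFH, hFcard⟩ := hHinf.exists_subset_card_eq (L + 1)
    have hFne : F.Nonempty := Finset.card_pos.1 (by omega)
    obtain ⟨κ₀, hκ₀F⟩ := hFne
    set G : Finset (Fin m → ℤ) := F.image (fun κ => κ - κ₀) with hG
    have hGcard : G.card = F.card := Finset.card_image_of_injective _ sub_left_injective
    have hwin : ∀ g ∈ G, (fun k => u k + 2 * ↑Real.pi * I * ((κ₀ k + g k : ℤ) : ℂ)) ∈ V := by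
      intro g hg
      obtain ⟨κ, hκF, rfl⟩ := Finset.mem_image.1 hg
      have e : (fun k => u k + 2 * ↑Real.pi * I * ((κ₀ k + (κ - κ₀) k : ℤ) : ℂ)) =
          fun k => u k + 2 * ↑Real.pi * I * (κ k : ℂ) := by
        funext k; simp only [Pi.sub_apply, add_sub_cancel]
      rw [e]
      exact hFH (Finset.mem_coe.2 hκF)
    have hfinP : Set.Finite {v : Fin m → ℂ | ∀ g ∈ G, (fun k => v k + 2 * ↑Real.pi * I * (g k : ℂ)) ∈ V} :=
      hL G (by rw [hGcard, hFcard]; omega)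
    have hfinN : Set.Finite {v : Fin m → ℂ | ∀ g ∈ G, (fun k => v k - 2 * ↑Real.pi * I * (g k : ℂ)) ∈ V} := by
      have h := hL (G.image Neg.neg)
        (by rw [Finset.card_image_of_injective _ neg_injective, hGcard, hFcard]; omega)
      refine h.subset ?_
      intro v hv g hg
      obtain ⟨g', hg', rfl⟩ := Finset.mem_image.1 hg
      have h' := hv g' hg'
      have e : (fun k => v k + 2 * ↑Real.pi * I * ((-g') k : ℂ)) = fun k => v k - 2 * ↑Real.pi * I * (g' k : ℂ) := by
        funext k; simp only [Pi.neg_apply, Int.cast_neg]; ring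
      rw [e]; exact h'
    exact cellSelector hVdef u G κ₀ hwin hfinP hfinN

/-- **(S*) ON THE CORANK-ONE MIXED SECTOR OF EVERY RANK FOLLOWS FROM CELL-RECURRENCE FINITENESS.**  At a first failure `x` of rank
`n = m + 1` with `m` ℚ-independent mixed directions `M_k` (`e^{M_k·x} ∈ ℚ̄`): if large cells recur at finitely many positions of the
joint value set `V = {(M_k·x')_k : x' mate}`, then every coordinate of `x` lies in `acl^{ℂ_exp}(∅)` (`intCombos_mem_expAcl_of_cellRecurrence`
and the acl-field criterion `firstFailure_mem_expAcl_of_intCombos`, which uses `SchanuelRank (n − 1)`).  This is the exact input the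
`window-cells` approach to item 14744 has to supply on this sector. [cite: Kirby2010, Prop. 7.2] -/
theorem mem_expAcl_of_corankOne_cellRecurrence {x : Fin n → ℂ} (hx : x ∈ firstFailures n) (hmn : n = m + 1)
    (M : Fin m → Fin n → ℤ) (hli : LinearIndependent ℚ (fun k => ∑ i, (M k i : ℂ) * x i))
    (halg : ∀ k, IsAlgebraic ℚ (cexp (∑ i, (M k i : ℂ) * x i)))
    (hrec : ∃ L : ℕ, ∀ G : Finset (Fin m → ℤ), L ≤ G.card →
      Set.Finite {v : Fin m → ℂ | ∀ g ∈ G, (fun k => v k + 2 * ↑Real.pi * I * (g k : ℂ)) ∈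
        {v : Fin m → ℂ | ∃ x' ∈ locusMates x, ∀ k, v k = ∑ i, (M k i : ℂ) * x' i}}) :
    ∀ i, x i ∈ expAcl :=
  firstFailure_mem_expAcl_of_intCombos hx hmn M hli (intCombos_mem_expAcl_of_cellRecurrence hx.1 M halg hrec)

/-! ## Registered form (explicit binders, fully qualified; `ledger workitem stub-add stmt-Schanuel-0969 --name stub_corankOneMixed_cellRecurrence …`) -/

/-- Registered form of `mem_expAcl_of_corankOne_cellRecurrence` (stub `stub_corankOneMixed_cellRecurrence` of crux stmt-Schanuel-0969, line
kernel-arithmetic-selection, lead c5). -/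
theorem stub_corankOneMixed_cellRecurrence : ∀ (n m : ℕ) (x : Fin n → ℂ), x ∈ Summit.Schanuel.Schanuel.Cruxes.MinimalCounterexampleInAcl.KernelArithmeticSelection.firstFailures n → n = m + 1 → ∀ (M : Fin m → Fin n → ℤ), LinearIndependent ℚ (fun k => ∑ i, (M k i : ℂ) * x i) → (∀ k, IsAlgebraic ℚ (Complex.exp (∑ i, (M k i : ℂ) * x i))) → (∃ L : ℕ, ∀ G : Finset (Fin m → ℤ), L ≤ G.card → Set.Finite {v : Fin m → ℂ | ∀ g ∈ G, (fun k => v k + 2 * ↑Real.pi * Complex.I * (g k : ℂ)) ∈ {v : Fin m → ℂ | ∃ x' ∈ Summit.Schanuel.Schanuel.Cruxes.MinimalCounterexampleInAcl.KernelArithmeticSelection.locusMates x, ∀ k, v k = ∑ i, (M k i : ℂ) * x' i}}) → ∀ i, x i ∈ Summit.Schanuel.Schanuel.Theorems.AclSubsetLogFreeCore.Negative.expAcl :=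
  fun _ _ _ hx hmn M hli halg hrec => mem_expAcl_of_corankOne_cellRecurrence hx hmn M hli halg hrec

end Summit.Schanuel.Schanuel.Cruxes.MinimalCounterexampleInAcl.KernelArithmeticSelection

end
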